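import Summits.QuantumFields.BalabanUV.Beta.GAN24.ExponentialChartBaseCovariantTaylor

/-!
# `BalabanUV.Beta.GAN24.ExponentialChartBaseCovariantTaylorEnd` — binder row G-an2-4 ∕ (CONV-C), route R7 «TWO CURRENCIES», PART 269: THE ONE-LOOP HESSIAN OF THE EXACT ABELIAN
# COVARIANT VECTOR LAPLACIAN AT A NONZERO SMALL ABELIAN BACKGROUND `U₀ = e^{iηA₀}` HAS THE β-CELL's WHOLE `LimitRate` END ON `ℤ^d` — displaying only `(α, β)` and EL₁ of the real
# directions `A_t, B_t`, the constants `(α₀, β₀)` ∕ `(α₀′, β₀′)` of the base connection `−w₀,t = connV U₀,t` and of `z₀,t = zT U₀,t` on the three-condition disc at coupling `1`, and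
# EL₁ of `−w₀,t`, `z₀,t`: PART 268's every-volume identity (five diagrams with PERTURBED propagators) + PART 264 (every diagram at a base point has the END) on the alphabet `Fin 3`
# of PART 267's twisted letters; invertibility at the base from NE2's Neumann bound and PART 249's Neumann ratio at coupling `1` (PART 254 is `A₀ = 0`) (unit b2b-balaban-gan24-p3,
# gen 67; v1; generator `HOME/b2b-balaban-gan24-p3/gen67/records/gen/gen268.py`)

NOT IN PRINT; OUR PROOF ([folklore] bookkeeping BY NAME over PART 268 (`deriv_deriv_invCov_expChartAt₂_eq_mixedDiagram`, `isUnit_det_of_norm_one_sub_smul_lt`), PART 267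
(`lipschitzBackground_baseJetV ∕ _baseMixedJetV`, `boundedBackground_baseJetZ ∕ _baseMixedJetZ`, `basePhase_eq`, `baseConjPhase_eq`), PART 264
(`conv_couplingDiagramSumAt_of_tendsto_background`), PART 249 (`opNorm_one_sub_smul_pertCov_le_coupling`), PART 236 (`perturbationLaws_couplingLetter`), NE2's `covPert_eq`,
`isUnit_det_add_smul_right`, `one_sub_smul_reindex`, `opNorm_reindex`; Mathlib's `Fin.sum_univ_five`, `tendsto_finsetSum`; [Balaban1985BackgroundPropagators] (3.3) p. 390, (3.35)
p. 396 and [Balaban1987RG1] (1.20)–(1.22) p. 264 LOCATE the shapes; nothing printed is a hypothesis).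
HONEST FRAMING (cell contract, verbatim): «discharging `BetaPertH` makes Bałaban's UV stability UNCONDITIONAL — a real constructive-QFT result; it is NOT the
continuum limit and NOT the Clay problem.»  HONEST DEPENDENCY (verbatim): «continuum YM on T⁴ ⇐ BetaPertH ∧ nine spine estimates (0/9 proved); BetaPertH ⇐
(D1) ∧ (D4) ∧ CAP+tail; G-an2-4 gates asym, D1 and NE2/3/4.»

WHAT THIS FILE PROVES (0 sorry, 0 `def`; `d ≥ 3`, `L ≥ 2`, `a > 0`, `μ ≠ ν`, even cubic volumes `2(t+1)`; admissible `(a′, κ)`; the base on the three-condition disc at coupling `1`):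
* **`conv_deriv_deriv_invCov_expChartAt₂_of_tendsto`**: `∃ κ₁ > 0, B₀, B′ ≥ 0, Π` with `IsInfiniteVolumeLimit`, `UniformDecay Π μ ν B₀ (κ₁∕d)`, `StepRate Π μ ν B′ (κ₁∕d) (√(L⁻¹))`,
  `KernelInputs d Π`, `∀ k, |secondMoment (Π k) μ ν − secondMoment (limKernelOf Π) μ ν| ≤ β′_d(B′∕(1−√(L⁻¹)), κ₁∕d)·(√(L⁻¹))^k` — for the tower family
  `(t, k) ↦ ∂_r|₀∂_s|₀[(L^{dk}Q_k(Δ_a^{(k)} + (Δ^{exp(iη(A₀,t + sA_t + rB_t))} − Δ^1))⁻¹Q_kᴴ)⁻¹]`.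
WHAT IT DOES NOT DO: base connections outside the disc (large fields); colour; Bałaban's `−∂P∂*` ∕ `aQ(U)*Q(U)` parts; the identification with row an1's `Π⁰_{k+1}`; the symmetry ∕
bilinearity bookkeeping at the base point (PARTs 255–259's pattern applies verbatim).  SUPPLIER work; NEVER «G-an2-4 closed»; NOT (CONV-C), NOT D1, NOT `BetaPertH`, NOT continuum,
NOT Clay.  Records: `HOME/b2b-balaban-gan24-p3/gen67/README.md`.
-/

noncomputable section

open scoped BigOperators ComplexConjugate Matrix Matrix.Norms.L2Operator
open Filter Topology

namespace Summit.QuantumFields.BalabanUV.Beta.GAN24.ExponentialChartBaseCovariantTaylorEnd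

open Literature.MathematicalPhysics.QuantumFieldTheory.Balaban1983to89
open Literature.MathematicalPhysics.QuantumFieldTheory.Balaban1983to89.B5Prop11Plancherel (Tor fine Cst Cst_nonneg opNorm_reindex)
open Literature.MathematicalPhysics.QuantumFieldTheory.Balaban1983to89.B5G183RateUnitTower (lev)
open Literature.MathematicalPhysics.QuantumFieldTheory.Balaban1983to89.B12Sec2to5 (betaPrime510)
open Literature.MathematicalPhysics.QuantumFieldTheory.Balaban1983to89.Beta (Site IsInfiniteVolumeLimit)
open Literature.MathematicalPhysics.QuantumFieldTheory.Balaban1983to89.Beta.FreeLegDictionary (cubic)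
open Literature.MathematicalPhysics.QuantumFieldTheory.Balaban1983to89.Beta.BlockKernelVolumeSockets (evenPeriod)
open Literature.MathematicalPhysics.QuantumFieldTheory.Balaban1983to89.Beta.VectorTails (castT)
open Literature.MathematicalPhysics.QuantumFieldTheory.Balaban1983to89.Beta.LimitRate (StepRate limKernelOf KernelInputs)
open Summit.QuantumFields.BalabanUV.T4Continuum
open Summit.QuantumFields.BalabanUV.T4Continuum.CovariantAveragingTower (avgTow)
open Summit.QuantumFields.BalabanUV.T4Continuum.BalabanAveragedTowerUnit (idx QBlev)
open Summit.QuantumFields.BalabanUV.T4Continuum.BalabanAveragedCoerciveTower (unitIdx)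
open Summit.QuantumFields.BalabanUV.T4Continuum.BalabanAveragedCoercive (gammaB gammaB_pos)
open Summit.QuantumFields.BalabanUV.T4Continuum.KingPairingPlantedLaw (calDalev isUnit_det_calDalev)
open Summit.QuantumFields.BalabanUV.T4Continuum.FirstOrderBackgroundModel (LipschitzBackground Pmodel)
open Summit.QuantumFields.BalabanUV.T4Continuum.PerturbationAlgebra (BoundedBackground)
open Summit.QuantumFields.BalabanUV.T4Continuum.AbelianCovariantLaplacian (covPert covPert_eq connV zT)
open Summit.QuantumFields.BalabanUV.T4Continuum.BackgroundResolventLaw (isUnit_det_add_smul_right)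
open Summit.QuantumFields.BalabanUV.T4Continuum.CTConjugatedHbd (G2)
open Summit.QuantumFields.BalabanUV.T4Continuum.DirichletRegionTower (gamD)
open Summit.QuantumFields.BalabanUV.T4Continuum.ScalarAveragedPropagator (gammaPs)
open Summit.QuantumFields.BalabanUV.T4Continuum.ScalarAveragedCompression (sigma0)
open Summit.QuantumFields.BalabanUV.T4Continuum.CTScalarGreen (Jfree)
open Summit.QuantumFields.BalabanUV.T4Continuum.CTGaugeTerm (deltaK)
open Summit.QuantumFields.BalabanUV.T4Continuum.CTVectorPropagator (JA)
open Summit.QuantumFields.BalabanUV.Beta.GAN24.VolumeLimitCovariance (one_sub_smul_reindex)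
open Summit.QuantumFields.BalabanUV.Beta.GAN24.CouplingLetterStencil (perturbationLaws_couplingLetter)
open Summit.QuantumFields.BalabanUV.Beta.GAN24.CouplingPerturbedVolumeLimit (opNorm_one_sub_smul_pertCov_le_coupling)
open Summit.QuantumFields.BalabanUV.Beta.GAN24.CouplingDiagramsAtCoupling (conv_couplingDiagramSumAt_of_tendsto_background)
open Summit.QuantumFields.BalabanUV.Beta.GAN24.ExponentialChartMixedBackgrounds (lipschitzBackground_mono boundedBackground_mono)
open Summit.QuantumFields.BalabanUV.Beta.GAN24.ExponentialChartBaseBackgrounds (lipschitzBackground_baseJetV lipschitzBackground_baseMixedJetV boundedBackground_baseJetZ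
  boundedBackground_baseMixedJetZ basePhase_eq baseConjPhase_eq)
open Summit.QuantumFields.BalabanUV.Beta.GAN24.ExponentialChartBaseCovariantTaylor (isUnit_det_of_norm_one_sub_smul_lt deriv_deriv_invCov_expChartAt₂_eq_mixedDiagram)

variable {d : ℕ} (L : ℕ) [NeZero L]

/-! ## §1 THE END of the Hessian at the base point on `ℤ^d` (PART 268 §1 volume by volume, PART 264 on `Fin 3`) -/

section End

variable (a : ℝ) (ha : 0 < a)

/-- **`conv_deriv_deriv_invCov_expChartAt₂_of_tendsto` — THE ONE-LOOP HESSIAN OF THE EXACT ABELIAN COVARIANT VECTOR LAPLACIAN AT A NONZERO SMALL ABELIAN BACKGROUND HAS THE β-CELL's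
WHOLE `LimitRate` END ON `ℤ^d`** [our proof] (`d ≥ 3`, `L ≥ 2`, `a > 0`, `μ ≠ ν`, even cubic volumes `2(t+1)`; admissible `(a′, κ)`): for volume-indexed REAL `A₀,t` (base), `A_t, B_t`
(directions, `LipschitzBackground (α, β)` uniformly, EL₁), with the base connection `−w₀,t = connV U₀,t` Lipschitz `(α₀, β₀)` and `z₀,t = zT U₀,t` bounded `(α₀′, β₀′)` uniformly on the
three-condition disc at coupling `1` and with EL₁, the tower family `(t, k) ↦ ∂_r|₀∂_s|₀[(L^{dk}Q_k(Δ_a^{(k)} + (Δ^{U_{s,r}} − Δ^1))⁻¹Q_kᴴ)⁻¹]`, `U_{s,r} = exp(iη(A₀,t + sA_t + rB_t))`, has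
`∃ κ₁ > 0, B₀, B′ ≥ 0, Π` with `IsInfiniteVolumeLimit`, `UniformDecay`, `StepRate (√(L⁻¹))`, `KernelInputs`, `|secondMoment (Π k) − secondMoment (lim Π)| ≤ β′_d(B′∕(1−√(L⁻¹)),
      κ₁∕d)(√(L⁻¹))^k` —
§1 volume by volume (invertibility from NE2's Neumann bound and PART 249's ratio at coupling `1`), then PART 264 on the alphabet `Fin 3` (PART 267's twisted letters, PART 266's jets).
[cite: Balaban1985BackgroundPropagators, (3.3) p.390, (3.35) p.396 (shapes); Balaban1987RG1, (1.20)–(1.22) p.264 (shapes)] -/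
theorem conv_deriv_deriv_invCov_expChartAt₂_of_tendsto (hL : 2 ≤ L) (hd : 3 ≤ d) {μ ν : Fin d} (hne : μ ≠ ν) {α β α₀ β₀ α₀' β₀' a' κ : ℝ}
    (ha' : 0 < a') (hκ0 : 0 < κ)
    (hγ' : Jfree d a' κ 1 < gammaPs d a') (hδ' : deltaK d a' κ 1 < sigma0 d a' ^ 2) (hJA : JA d a a' κ 1 < gamD d a)
    (hT₁ : 1 * (2 * (d * (α₀ + β₀) * Cst d a) + α₀' * Cst d a) ≤ 1 / 2)
    (hT₂ : 1 * (d * (α₀ * G2 d a (max (JA d a a' κ 1) 0) (gamD d a - max (JA d a a' κ 1) 0) κ)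
      + d * (Real.exp |κ| * (α₀ * G2 d a (max (JA d a a' κ 1) 0) (gamD d a - max (JA d a a' κ 1) 0) κ + β₀ * (gamD d a - max (JA d a a' κ 1) 0)⁻¹))
      + α₀' * (gamD d a - max (JA d a a' κ 1) 0)⁻¹) ≤ 1 / 2)
    (hT₃ : 4 * 1 * (2 * (d * (α₀ + β₀) * Cst d a) + α₀' * Cst d a) * Cst d a ≤ gammaB d a)
    {A₀ A B : (t : ℕ) → (k : ℕ) → Fin d → (idx L (cubic d (evenPeriod t)) k → ℝ)}
    (hA : ∀ t, LipschitzBackground L (cubic d (evenPeriod t)) (fun k ν' x => (A t k ν' x : ℂ)) α β)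
    (hB : ∀ t, LipschitzBackground L (cubic d (evenPeriod t)) (fun k ν' x => (B t k ν' x : ℂ)) α β)
    (hw : ∀ t, LipschitzBackground L (cubic d (evenPeriod t)) (connV L (cubic d (evenPeriod t)) (fun k'' ν' (x' : idx L (cubic d (evenPeriod t)) k'') => Complex.exp (Complex.I * ((A₀ t) k''
          ν' x' : ℂ) / ((lev L k'' : ℕ) : ℂ)))) α₀ β₀)
    (hz : ∀ t, BoundedBackground L (cubic d (evenPeriod t)) (zT L (cubic d (evenPeriod t)) (fun k'' ν' (x' : idx L (cubic d (evenPeriod t)) k'') => Complex.exp (Complex.I * ((A₀ t) k'' ν'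
          x' : ℂ) / ((lev L k'' : ℕ) : ℂ)))) α₀' β₀')
    (hA1 : ∀ k (ν' f : Fin d) (z : Fin d → ℤ), ∃ s' : ℂ, Tendsto (fun t => ((A t k ν' (castT (cubic d (lev L k * evenPeriod t)) z, f) : ℝ) : ℂ)) atTop (𝓝 s'))
    (hB1 : ∀ k (ν' f : Fin d) (z : Fin d → ℤ), ∃ s' : ℂ, Tendsto (fun t => ((B t k ν' (castT (cubic d (lev L k * evenPeriod t)) z, f) : ℝ) : ℂ)) atTop (𝓝 s'))
    (hw1 : ∀ k (ν' f : Fin d) (z : Fin d → ℤ), ∃ s' : ℂ, Tendsto (fun t => connV L (cubic d (evenPeriod t)) (fun k'' ν' (x' : idx L (cubic d (evenPeriod t)) k'') => Complex.exp (Complex.I *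
          ((A₀ t) k'' ν' x' : ℂ) / ((lev L k'' : ℕ) : ℂ))) k ν' (castT (cubic d (lev L k * evenPeriod t)) z, f)) atTop (𝓝 s'))
    (hz1 : ∀ k (f : Fin d) (z : Fin d → ℤ), ∃ s' : ℂ, Tendsto (fun t => zT L (cubic d (evenPeriod t)) (fun k'' ν' (x' : idx L (cubic d (evenPeriod t)) k'') => Complex.exp (Complex.I * ((A₀
          t) k'' ν' x' : ℂ) / ((lev L k'' : ℕ) : ℂ))) k (castT (cubic d (lev L k * evenPeriod t)) z, f)) atTop (𝓝 s')) :
    ∃ κ₁ B₀ B' : ℝ, 0 < κ₁ ∧ 0 ≤ B₀ ∧ 0 ≤ B' ∧ ∃ Pinf : ℕ → B12Beta.Kernel d,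
      (∀ k, IsInfiniteVolumeLimit evenPeriod
        (fun t μ' ν' (z : Site d (evenPeriod t)) =>
          ((deriv (fun r : ℝ => deriv (fun s : ℝ => (avgTow (QBlev L (cubic d (evenPeriod t))) ((L : ℝ) ^ d)
        (fun k' => (calDalev L (cubic d (evenPeriod t)) a ha k' + covPert L (cubic d (evenPeriod t)) (fun k'' ν' (x' : idx L (cubic d (evenPeriod t)) k'') => Complex.exp (Complex.I * ((A₀
              t) k'' ν' x' : ℂ) / ((lev L k'' : ℕ) : ℂ) + (Complex.I * ((A t) k'' ν' x' : ℂ) / ((lev L k'' : ℕ) : ℂ)) * ((s : ℝ) : ℂ) + (Complex.I * ((B t) k'' ν' x' : ℂ) / ((lev L k'' : ℕ)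
              : ℂ)) * ((r : ℝ) : ℂ))) k')⁻¹) k)⁻¹) 0) 0)
            ((unitIdx L (cubic d (evenPeriod t))).symm (z, μ')) ((unitIdx L (cubic d (evenPeriod t))).symm (0, ν'))).re) (Pinf k)) ∧
      Beta.LimitRate.UniformDecay Pinf μ ν B₀ (κ₁ / d) ∧ StepRate Pinf μ ν B' (κ₁ / d) (Real.sqrt ((L : ℝ)⁻¹)) ∧
      (∃ K : KernelInputs d Pinf, K.θ = Real.sqrt ((L : ℝ)⁻¹) ∧ K.c₀ = betaPrime510 d (B' / (1 - Real.sqrt ((L : ℝ)⁻¹))) (κ₁ / d) ∧ K.Pinf = limKernelOf Pinf ∧ K.μ = μ ∧ K.ν = ν) ∧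
      (∀ k, |B12Beta.secondMoment (Pinf k) μ ν - B12Beta.secondMoment (limKernelOf Pinf) μ ν|
          ≤ betaPrime510 d (B' / (1 - Real.sqrt ((L : ℝ)⁻¹))) (κ₁ / d) * Real.sqrt ((L : ℝ)⁻¹) ^ k) := by
  have hd1 : 1 ≤ d := le_trans (by norm_num) hd
  have hα : 0 ≤ α := (hA 0).nonneg.1
  have hβ : 0 ≤ β := (hA 0).nonneg.2
  have hα₀ : 0 ≤ α₀ := (hw 0).nonneg.1
  have hβ₀ : 0 ≤ β₀ := (hw 0).nonneg.2
  have hα₀' : 0 ≤ α₀' := (hz 0).nonneg.1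
  have hβ₀' : 0 ≤ β₀' := (hz 0).nonneg.2
  have hu : ‖(1 : ℂ)‖ ≤ 1 := by rw [norm_one]
  -- the three letters: PART 267's constants, common bounds by `max`
  have hV : ∀ (i : Fin 3) (t : ℕ), LipschitzBackground L (cubic d (evenPeriod t)) ((fun (i : Fin 3) (t : ℕ) => (![(fun k'' ν' (x' : idx L (cubic d (evenPeriod t)) k'') => -(Complex.I * ((A
        t) k'' ν' x' : ℂ)) * Complex.exp (Complex.I * ((A₀ t) k'' ν' x' : ℂ) / ((lev L k'' : ℕ) : ℂ))), (fun k'' ν' (x' : idx L (cubic d (evenPeriod t)) k'') => -(Complex.I * ((B t) k'' ν'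
        x' : ℂ)) * Complex.exp (Complex.I * ((A₀ t) k'' ν' x' : ℂ) / ((lev L k'' : ℕ) : ℂ))), (fun k'' ν' (x' : idx L (cubic d (evenPeriod t)) k'') => -(Complex.I * ((A t) k'' ν' x' : ℂ)) *
        (Complex.I * ((B t) k'' ν' x' : ℂ) / ((lev L k'' : ℕ) : ℂ)) * Complex.exp (Complex.I * ((A₀ t) k'' ν' x' : ℂ) / ((lev L k'' : ℕ) : ℂ)))] : Fin 3 → ((k : ℕ) → Fin d → (idx L (cubic d
        (evenPeriod t)) k → ℂ))) i) i t)
      (max (α * (1 + α₀)) (α * α * (1 + α₀))) (max (α * (α₀ + β₀) + β * (1 + α₀)) (α * α * (α₀ + β₀) + (α * (α + β) + β * α) * (1 + α₀))) := by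
    intro i t
    fin_cases i
    · exact lipschitzBackground_mono L _ (lipschitzBackground_baseJetV L _ (hA t) (hw t)) (le_max_left _ _) (le_max_left _ _)
    · exact lipschitzBackground_mono L _ (lipschitzBackground_baseJetV L _ (hB t) (hw t)) (le_max_left _ _) (le_max_left _ _)
    · exact lipschitzBackground_mono L _ (lipschitzBackground_baseMixedJetV L _ (hA t) (hB t) (hw t)) (le_max_right _ _) (le_max_right _ _)
  have hW : ∀ (i : Fin 3) (t : ℕ), BoundedBackground L (cubic d (evenPeriod t)) ((fun (i : Fin 3) (t : ℕ) => (![(fun (k'' : ℕ) (x' : idx L (cubic d (evenPeriod t)) k'') => -((lev L k'' : ℕ)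
        : ℂ) * ∑ ν, (Complex.I * ((A t) k'' ν x' : ℂ)) * (Complex.exp (Complex.I * ((A₀ t) k'' ν x' : ℂ) / ((lev L k'' : ℕ) : ℂ)) - Complex.exp (-(Complex.I * ((A₀ t) k'' ν x' : ℂ) / ((lev
        L k'' : ℕ) : ℂ))))), (fun (k'' : ℕ) (x' : idx L (cubic d (evenPeriod t)) k'') => -((lev L k'' : ℕ) : ℂ) * ∑ ν, (Complex.I * ((B t) k'' ν x' : ℂ)) * (Complex.exp (Complex.I * ((A₀ t)
        k'' ν x' : ℂ) / ((lev L k'' : ℕ) : ℂ)) - Complex.exp (-(Complex.I * ((A₀ t) k'' ν x' : ℂ) / ((lev L k'' : ℕ) : ℂ))))), (fun (k'' : ℕ) (x' : idx L (cubic d (evenPeriod t)) k'') => -∑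
        ν, (Complex.I * ((A t) k'' ν x' : ℂ)) * (Complex.I * ((B t) k'' ν x' : ℂ)) * (Complex.exp (Complex.I * ((A₀ t) k'' ν x' : ℂ) / ((lev L k'' : ℕ) : ℂ)) + Complex.exp (-(Complex.I *
        ((A₀ t) k'' ν x' : ℂ) / ((lev L k'' : ℕ) : ℂ)))))] : Fin 3 → ((k : ℕ) → (idx L (cubic d (evenPeriod t)) k → ℂ))) i) i t)
      (max (d * (α * (α₀ + α₀))) (d * (α * α * ((1 + α₀) + (1 + α₀)))))
      (max (d * (α * (β₀ + β₀) + β * (α₀ + α₀))) (d * (α * α * ((α₀ + β₀) + (α₀ + β₀)) + (α * β + β * α) * ((1 + α₀) + (1 + α₀))))) := by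
    intro i t
    fin_cases i
    · exact boundedBackground_mono L _ (boundedBackground_baseJetZ L _ (hA t) (hw t)) (le_max_left _ _) (le_max_left _ _)
    · exact boundedBackground_mono L _ (boundedBackground_baseJetZ L _ (hB t) (hw t)) (le_max_left _ _) (le_max_left _ _)
    · exact boundedBackground_mono L _ (boundedBackground_baseMixedJetZ L _ (hA t) (hB t) (hw t)) (le_max_right _ _) (le_max_right _ _)
  have hcα : 0 ≤ max (α * (1 + α₀)) (α * α * (1 + α₀)) := (hV 0 0).nonneg.1
  have hcβ : 0 ≤ max (α * (α₀ + β₀) + β * (1 + α₀)) (α * α * (α₀ + β₀) + (α * (α + β) + β * α) * (1 + α₀)) := (hV 0 0).nonneg.2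
  have hcα' : 0 ≤ max (d * (α * (α₀ + α₀))) (d * (α * α * ((1 + α₀) + (1 + α₀)))) := (hW 0 0).nonneg.1
  have hcβ' : 0 ≤ max (d * (α * (β₀ + β₀) + β * (α₀ + α₀))) (d * (α * α * ((α₀ + β₀) + (α₀ + β₀)) + (α * β + β * α) * ((1 + α₀) + (1 + α₀)))) := (hW 0 0).nonneg.2
  -- EL₁ of the base phases `e^{±θ₀,t}` from EL₁ of the base connection (`e^{θ₀} = 1 − V₀∕n`, `e^{−θ₀} = 1 − V̄₀∕n`)
  have hE1 : ∀ k (ν' f : Fin d) (z : Fin d → ℤ), ∃ e : ℂ, Tendsto (fun t => Complex.exp (Complex.I * ((A₀ t) k ν' (castT (cubic d (lev L k * evenPeriod t)) z, f) : ℂ) / ((lev L k : ℕ) :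
        ℂ))) atTop (𝓝 e) := by
    intro k ν' f z
    obtain ⟨s, hs⟩ := hw1 k ν' f z
    refine ⟨(1 : ℂ) + (-1 : ℂ) * (s / ((lev L k : ℕ) : ℂ)), (tendsto_const_nhds.add ((hs.div_const _).const_mul (-1 : ℂ))).congr fun t => ?_⟩
    exact (congrFun (congrFun (congrFun (basePhase_eq L (cubic d (evenPeriod t)) (A₀ t)) k) ν') (castT (cubic d (lev L k * evenPeriod t)) z, f)).symm
  have hE2 : ∀ k (ν' f : Fin d) (z : Fin d → ℤ), ∃ e : ℂ, Tendsto (fun t => Complex.exp (-(Complex.I * ((A₀ t) k ν' (castT (cubic d (lev L k * evenPeriod t)) z, f) : ℂ) / ((lev L k : ℕ) :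
        ℂ)))) atTop (𝓝 e) := by
    intro k ν' f z
    obtain ⟨s, hs⟩ := hw1 k ν' f z
    refine ⟨(1 : ℂ) + (-1 : ℂ) * (star s / ((lev L k : ℕ) : ℂ)), (tendsto_const_nhds.add ((hs.star.div_const _).const_mul (-1 : ℂ))).congr fun t => ?_⟩
    exact (congrFun (congrFun (congrFun (baseConjPhase_eq L (cubic d (evenPeriod t)) (A₀ t)) k) ν') (castT (cubic d (lev L k * evenPeriod t)) z, f)).symm
  have hV1 : ∀ (i : Fin 3) k (ν' f : Fin d) (z : Fin d → ℤ), ∃ s' : ℂ,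
      Tendsto (fun t => (fun (i : Fin 3) (t : ℕ) => (![(fun k'' ν' (x' : idx L (cubic d (evenPeriod t)) k'') => -(Complex.I * ((A t) k'' ν' x' : ℂ)) * Complex.exp (Complex.I * ((A₀ t) k''
            ν' x' : ℂ) / ((lev L k'' : ℕ) : ℂ))), (fun k'' ν' (x' : idx L (cubic d (evenPeriod t)) k'') => -(Complex.I * ((B t) k'' ν' x' : ℂ)) * Complex.exp (Complex.I * ((A₀ t) k'' ν' x'
            : ℂ) / ((lev L k'' : ℕ) : ℂ))), (fun k'' ν' (x' : idx L (cubic d (evenPeriod t)) k'') => -(Complex.I * ((A t) k'' ν' x' : ℂ)) * (Complex.I * ((B t) k'' ν' x' : ℂ) / ((lev L k''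
            : ℕ) : ℂ)) * Complex.exp (Complex.I * ((A₀ t) k'' ν' x' : ℂ) / ((lev L k'' : ℕ) : ℂ)))] : Fin 3 → ((k : ℕ) → Fin d → (idx L (cubic d (evenPeriod t)) k → ℂ))) i) i t k ν' (castT
            (cubic d (lev L k * evenPeriod t)) z, f)) atTop (𝓝 s') := by
    intro i k ν' f z
    obtain ⟨sA, hsA⟩ := hA1 k ν' f z
    obtain ⟨sB, hsB⟩ := hB1 k ν' f z
    obtain ⟨e, he⟩ := hE1 k ν' f z
    fin_cases i
    · exact ⟨-(Complex.I * sA) * e, (hsA.const_mul Complex.I).neg.mul he⟩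
    · exact ⟨-(Complex.I * sB) * e, (hsB.const_mul Complex.I).neg.mul he⟩
    · exact ⟨-(Complex.I * sA) * (Complex.I * sB / ((lev L k : ℕ) : ℂ)) * e, ((hsA.const_mul Complex.I).neg.mul ((hsB.const_mul Complex.I).div_const _)).mul he⟩
  have hW1 : ∀ (i : Fin 3) k (f : Fin d) (z : Fin d → ℤ), ∃ s' : ℂ,
      Tendsto (fun t => (fun (i : Fin 3) (t : ℕ) => (![(fun (k'' : ℕ) (x' : idx L (cubic d (evenPeriod t)) k'') => -((lev L k'' : ℕ) : ℂ) * ∑ ν, (Complex.I * ((A t) k'' ν x' : ℂ)) *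
            (Complex.exp (Complex.I * ((A₀ t) k'' ν x' : ℂ) / ((lev L k'' : ℕ) : ℂ)) - Complex.exp (-(Complex.I * ((A₀ t) k'' ν x' : ℂ) / ((lev L k'' : ℕ) : ℂ))))), (fun (k'' : ℕ) (x' : idx
            L (cubic d (evenPeriod t)) k'') => -((lev L k'' : ℕ) : ℂ) * ∑ ν, (Complex.I * ((B t) k'' ν x' : ℂ)) * (Complex.exp (Complex.I * ((A₀ t) k'' ν x' : ℂ) / ((lev L k'' : ℕ) : ℂ)) -
            Complex.exp (-(Complex.I * ((A₀ t) k'' ν x' : ℂ) / ((lev L k'' : ℕ) : ℂ))))), (fun (k'' : ℕ) (x' : idx L (cubic d (evenPeriod t)) k'') => -∑ ν, (Complex.I * ((A t) k'' ν x' :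
            ℂ)) * (Complex.I * ((B t) k'' ν x' : ℂ)) * (Complex.exp (Complex.I * ((A₀ t) k'' ν x' : ℂ) / ((lev L k'' : ℕ) : ℂ)) + Complex.exp (-(Complex.I * ((A₀ t) k'' ν x' : ℂ) / ((lev L
            k'' : ℕ) : ℂ)))))] : Fin 3 → ((k : ℕ) → (idx L (cubic d (evenPeriod t)) k → ℂ))) i) i t k (castT (cubic d (lev L k * evenPeriod t)) z, f)) atTop (𝓝 s') := by
    intro i k f z
    choose sA hsA using fun (ν' : Fin d) => hA1 k ν' f z
    choose sB hsB using fun (ν' : Fin d) => hB1 k ν' f z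
    choose e he using fun (ν' : Fin d) => hE1 k ν' f z
    choose e' he' using fun (ν' : Fin d) => hE2 k ν' f z
    fin_cases i
    · exact ⟨-((lev L k : ℕ) : ℂ) * ∑ ν', (Complex.I * sA ν') * (e ν' - e' ν'),
        (tendsto_finsetSum _ fun ν' _ => ((hsA ν').const_mul Complex.I).mul ((he ν').sub (he' ν'))).const_mul _⟩
    · exact ⟨-((lev L k : ℕ) : ℂ) * ∑ ν', (Complex.I * sB ν') * (e ν' - e' ν'),
        (tendsto_finsetSum _ fun ν' _ => ((hsB ν').const_mul Complex.I).mul ((he ν').sub (he' ν'))).const_mul _⟩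
    · exact ⟨-∑ ν', (Complex.I * sA ν') * (Complex.I * sB ν') * (e ν' + e' ν'),
        (tendsto_finsetSum _ fun ν' _ => (((hsA ν').const_mul Complex.I).mul ((hsB ν').const_mul Complex.I)).mul ((he ν').add (he' ν'))).neg⟩
  obtain ⟨κ₁, B₀, B', hκ₁, hB₀, hB', Pinf, hIVL, hUD, hSR, hK, hsm⟩ :=
    conv_couplingDiagramSumAt_of_tendsto_background L a ha hL hd hα₀ hβ₀ hα₀' hβ₀' hcα hcβ hcα' hcβ' ha' hκ0 hγ' hδ' hJA zero_le_one hT₁ hT₂ hT₃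
      (U₁ := (fun t => connV L (cubic d (evenPeriod t)) (fun k'' ν' (x' : idx L (cubic d (evenPeriod t)) k'') => Complex.exp (Complex.I * ((A₀ t) k'' ν' x' : ℂ) / ((lev L k'' : ℕ) : ℂ)))))
            (U₂ := (fun t => connV L (cubic d (evenPeriod t)) (fun k'' ν' (x' : idx L (cubic d (evenPeriod t)) k'') => Complex.exp (Complex.I * ((A₀ t) k'' ν' x' : ℂ) / ((lev L k'' : ℕ) :
            ℂ))))) (Z := (fun t => zT L (cubic d (evenPeriod t)) (fun k'' ν' (x' : idx L (cubic d (evenPeriod t)) k'') => Complex.exp (Complex.I * ((A₀ t) k'' ν' x' : ℂ) / ((lev L k'' : ℕ)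
            : ℂ)))))
      hw hw hz hw1 hw1 hz1
      (V₁ := (fun (i : Fin 3) (t : ℕ) => (![(fun k'' ν' (x' : idx L (cubic d (evenPeriod t)) k'') => -(Complex.I * ((A t) k'' ν' x' : ℂ)) * Complex.exp (Complex.I * ((A₀ t) k'' ν' x' : ℂ) /
            ((lev L k'' : ℕ) : ℂ))), (fun k'' ν' (x' : idx L (cubic d (evenPeriod t)) k'') => -(Complex.I * ((B t) k'' ν' x' : ℂ)) * Complex.exp (Complex.I * ((A₀ t) k'' ν' x' : ℂ) / ((lev
            L k'' : ℕ) : ℂ))), (fun k'' ν' (x' : idx L (cubic d (evenPeriod t)) k'') => -(Complex.I * ((A t) k'' ν' x' : ℂ)) * (Complex.I * ((B t) k'' ν' x' : ℂ) / ((lev L k'' : ℕ) : ℂ)) *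
            Complex.exp (Complex.I * ((A₀ t) k'' ν' x' : ℂ) / ((lev L k'' : ℕ) : ℂ)))] : Fin 3 → ((k : ℕ) → Fin d → (idx L (cubic d (evenPeriod t)) k → ℂ))) i))
      (V₂ := (fun (i : Fin 3) (t : ℕ) => (![(fun k'' ν' (x' : idx L (cubic d (evenPeriod t)) k'') => -(Complex.I * ((A t) k'' ν' x' : ℂ)) * Complex.exp (Complex.I * ((A₀ t) k'' ν' x' : ℂ) /
            ((lev L k'' : ℕ) : ℂ))), (fun k'' ν' (x' : idx L (cubic d (evenPeriod t)) k'') => -(Complex.I * ((B t) k'' ν' x' : ℂ)) * Complex.exp (Complex.I * ((A₀ t) k'' ν' x' : ℂ) / ((lev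
            L k'' : ℕ) : ℂ))), (fun k'' ν' (x' : idx L (cubic d (evenPeriod t)) k'') => -(Complex.I * ((A t) k'' ν' x' : ℂ)) * (Complex.I * ((B t) k'' ν' x' : ℂ) / ((lev L k'' : ℕ) : ℂ)) *
            Complex.exp (Complex.I * ((A₀ t) k'' ν' x' : ℂ) / ((lev L k'' : ℕ) : ℂ)))] : Fin 3 → ((k : ℕ) → Fin d → (idx L (cubic d (evenPeriod t)) k → ℂ))) i))
      (W := (fun (i : Fin 3) (t : ℕ) => (![(fun (k'' : ℕ) (x' : idx L (cubic d (evenPeriod t)) k'') => -((lev L k'' : ℕ) : ℂ) * ∑ ν, (Complex.I * ((A t) k'' ν x' : ℂ)) * (Complex.exp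
            (Complex.I * ((A₀ t) k'' ν x' : ℂ) / ((lev L k'' : ℕ) : ℂ)) - Complex.exp (-(Complex.I * ((A₀ t) k'' ν x' : ℂ) / ((lev L k'' : ℕ) : ℂ))))), (fun (k'' : ℕ) (x' : idx L (cubic d
            (evenPeriod t)) k'') => -((lev L k'' : ℕ) : ℂ) * ∑ ν, (Complex.I * ((B t) k'' ν x' : ℂ)) * (Complex.exp (Complex.I * ((A₀ t) k'' ν x' : ℂ) / ((lev L k'' : ℕ) : ℂ)) - Complex.exp
            (-(Complex.I * ((A₀ t) k'' ν x' : ℂ) / ((lev L k'' : ℕ) : ℂ))))), (fun (k'' : ℕ) (x' : idx L (cubic d (evenPeriod t)) k'') => -∑ ν, (Complex.I * ((A t) k'' ν x' : ℂ)) *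
            (Complex.I * ((B t) k'' ν x' : ℂ)) * (Complex.exp (Complex.I * ((A₀ t) k'' ν x' : ℂ) / ((lev L k'' : ℕ) : ℂ)) + Complex.exp (-(Complex.I * ((A₀ t) k'' ν x' : ℂ) / ((lev L k'' :
            ℕ) : ℂ)))))] : Fin 3 → ((k : ℕ) → (idx L (cubic d (evenPeriod t)) k → ℂ))) i))
      hV hV hW hV1 hV1 hW1 hu hne (Finset.univ : Finset (Fin 5)) (![1, 1, -1, -1, 1] : Fin 5 → ℂ)
      (![[none, some [1], none, some [0], none], [none, some [0], none, some [1], none], [none, some [1, 0], none], [none, some [0, 1], none], [none, some [2], none]] : Fin 5 → List (Option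
            (List (Fin 3))))
  refine ⟨κ₁, B₀, B', hκ₁, hB₀, hB', Pinf, fun k => ?_, hUD, hSR, hK, hsm⟩
  -- invertibility at the base point, volume by volume (NE2's Neumann bound; PART 249's ratio at coupling `1`)
  have hC : 0 < Cst d a := lt_of_lt_of_le zero_lt_one (le_max_of_le_right (le_max_right _ _))
  have hκ₀0 : 0 ≤ 2 * (d * (α₀ + β₀) * Cst d a) + α₀' * Cst d a := by have := hC.le; positivity
  have ht1 : ‖(1 : ℂ)‖ * (2 * (d * (α₀ + β₀) * Cst d a) + α₀' * Cst d a) < 1 := by rw [norm_one]; linarith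
  have h0 : ∀ t, IsUnit (calDalev L (cubic d (evenPeriod t)) a ha k + covPert L (cubic d (evenPeriod t)) (fun k'' ν' (x' : idx L (cubic d (evenPeriod t)) k'') => Complex.exp (Complex.I *
        ((A₀ t) k'' ν' x' : ℂ) / ((lev L k'' : ℕ) : ℂ))) k).det := by
    intro t
    have h := isUnit_det_add_smul_right (isUnit_det_calDalev L (cubic d (evenPeriod t)) a ha k) ((perturbationLaws_couplingLetter L (cubic d (evenPeriod t)) a ha hd1 (hw t) (hw t) (hz
          t)).opNorm_P_mul_inv_le k) ht1
    rw [one_smul, ← covPert_eq] at h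
    exact h
  have hc0 : ∀ t, IsUnit (avgTow (QBlev L (cubic d (evenPeriod t))) ((L : ℝ) ^ d) (fun k' => (calDalev L (cubic d (evenPeriod t)) a ha k' + covPert L (cubic d (evenPeriod t)) (fun k'' ν'
        (x' : idx L (cubic d (evenPeriod t)) k'') => Complex.exp (Complex.I * ((A₀ t) k'' ν' x' : ℂ) / ((lev L k'' : ℕ) : ℂ))) k')⁻¹) k).det := by
    intro t
    have h := opNorm_one_sub_smul_pertCov_le_coupling L (cubic d (evenPeriod t)) a ha hd1 (hw t) (hw t) (hz t) hT₁ hT₃ hu k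
    rw [one_sub_smul_reindex, opNorm_reindex] at h
    simp only [one_smul, ← covPert_eq] at h
    have hlt : 1 - gammaB d a / (2 * Cst d a) < 1 := by
      have := div_pos (gammaB_pos (d := d) a ha) (mul_pos two_pos hC)
      linarith
    exact isUnit_det_of_norm_one_sub_smul_lt (h.trans_lt hlt)
  -- the identity, volume by volume
  have key : ∀ t, deriv (fun r : ℝ => deriv (fun s : ℝ => (avgTow (QBlev L (cubic d (evenPeriod t))) ((L : ℝ) ^ d)
        (fun k' => (calDalev L (cubic d (evenPeriod t)) a ha k' + covPert L (cubic d (evenPeriod t)) (fun k'' ν' (x' : idx L (cubic d (evenPeriod t)) k'') => Complex.exp (Complex.I * ((A₀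
              t) k'' ν' x' : ℂ) / ((lev L k'' : ℕ) : ℂ) + (Complex.I * ((A t) k'' ν' x' : ℂ) / ((lev L k'' : ℕ) : ℂ)) * ((s : ℝ) : ℂ) + (Complex.I * ((B t) k'' ν' x' : ℂ) / ((lev L k'' : ℕ)
              : ℂ)) * ((r : ℝ) : ℂ))) k')⁻¹) k)⁻¹) 0) 0
      = (∑ j ∈ (Finset.univ : Finset (Fin 5)), (![1, 1, -1, -1, 1] : Fin 5 → ℂ) j • ((((![[none, some [1], none, some [0], none], [none, some [0], none, some [1], none], [none, some [1, 0],
            none], [none, some [0, 1], none], [none, some [2], none]] : Fin 5 → List (Option (List (Fin 3))))) j).map fun o => o.elim (fun t k => (avgTow (QBlev L (cubic d (evenPeriod t)))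
            ((L : ℝ) ^ d)
            (fun k' => (calDalev L (cubic d (evenPeriod t)) a ha k' + (1 : ℂ) • (Pmodel L (cubic d (evenPeriod t)) ((fun t => connV L (cubic d (evenPeriod t)) (fun k'' ν' (x' : idx L (cubic
                  d (evenPeriod t)) k'') => Complex.exp (Complex.I * ((A₀ t) k'' ν' x' : ℂ) / ((lev L k'' : ℕ) : ℂ)))) t) k' + (Pmodel L (cubic d (evenPeriod t)) ((fun t => connV L (cubic d
                  (evenPeriod t)) (fun k'' ν' (x' : idx L (cubic d (evenPeriod t)) k'') => Complex.exp (Complex.I * ((A₀ t) k'' ν' x' : ℂ) / ((lev L k'' : ℕ) : ℂ)))) t) k')ᴴ +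
                  Matrix.diagonal ((fun t => zT L (cubic d (evenPeriod t)) (fun k'' ν' (x' : idx L (cubic d (evenPeriod t)) k'') => Complex.exp (Complex.I * ((A₀ t) k'' ν' x' : ℂ) / ((lev L
                  k'' : ℕ) : ℂ)))) t k')))⁻¹) k)⁻¹)
          (fun w t k => avgTow (QBlev L (cubic d (evenPeriod t))) ((L : ℝ) ^ d)
            (fun k' => List.foldr (fun i N =>
                (calDalev L (cubic d (evenPeriod t)) a ha k' + (1 : ℂ) • (Pmodel L (cubic d (evenPeriod t)) ((fun t => connV L (cubic d (evenPeriod t)) (fun k'' ν' (x' : idx L (cubic d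
                      (evenPeriod t)) k'') => Complex.exp (Complex.I * ((A₀ t) k'' ν' x' : ℂ) / ((lev L k'' : ℕ) : ℂ)))) t) k' + (Pmodel L (cubic d (evenPeriod t)) ((fun t => connV L (cubic
                      d (evenPeriod t)) (fun k'' ν' (x' : idx L (cubic d (evenPeriod t)) k'') => Complex.exp (Complex.I * ((A₀ t) k'' ν' x' : ℂ) / ((lev L k'' : ℕ) : ℂ)))) t) k')ᴴ +
                      Matrix.diagonal ((fun t => zT L (cubic d (evenPeriod t)) (fun k'' ν' (x' : idx L (cubic d (evenPeriod t)) k'') => Complex.exp (Complex.I * ((A₀ t) k'' ν' x' : ℂ) /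
                      ((lev L k'' : ℕ) : ℂ)))) t k')))⁻¹
                * (Pmodel L (cubic d (evenPeriod t)) ((fun (i : Fin 3) (t : ℕ) => (![(fun k'' ν' (x' : idx L (cubic d (evenPeriod t)) k'') => -(Complex.I * ((A t) k'' ν' x' : ℂ)) *
                      Complex.exp (Complex.I * ((A₀ t) k'' ν' x' : ℂ) / ((lev L k'' : ℕ) : ℂ))), (fun k'' ν' (x' : idx L (cubic d (evenPeriod t)) k'') => -(Complex.I * ((B t) k'' ν' x' :
                      ℂ)) * Complex.exp (Complex.I * ((A₀ t) k'' ν' x' : ℂ) / ((lev L k'' : ℕ) : ℂ))), (fun k'' ν' (x' : idx L (cubic d (evenPeriod t)) k'') => -(Complex.I * ((A t) k'' ν'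
                      x' : ℂ)) * (Complex.I * ((B t) k'' ν' x' : ℂ) / ((lev L k'' : ℕ) : ℂ)) * Complex.exp (Complex.I * ((A₀ t) k'' ν' x' : ℂ) / ((lev L k'' : ℕ) : ℂ)))] : Fin 3 → ((k : ℕ)
                      → Fin d → (idx L (cubic d (evenPeriod t)) k → ℂ))) i) i t) k' + (Pmodel L (cubic d (evenPeriod t)) ((fun (i : Fin 3) (t : ℕ) => (![(fun k'' ν' (x' : idx L (cubic d
                      (evenPeriod t)) k'') => -(Complex.I * ((A t) k'' ν' x' : ℂ)) * Complex.exp (Complex.I * ((A₀ t) k'' ν' x' : ℂ) / ((lev L k'' : ℕ) : ℂ))), (fun k'' ν' (x' : idx L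
                      (cubic d (evenPeriod t)) k'') => -(Complex.I * ((B t) k'' ν' x' : ℂ)) * Complex.exp (Complex.I * ((A₀ t) k'' ν' x' : ℂ) / ((lev L k'' : ℕ) : ℂ))), (fun k'' ν' (x' :
                      idx L (cubic d (evenPeriod t)) k'') => -(Complex.I * ((A t) k'' ν' x' : ℂ)) * (Complex.I * ((B t) k'' ν' x' : ℂ) / ((lev L k'' : ℕ) : ℂ)) * Complex.exp (Complex.I *
                      ((A₀ t) k'' ν' x' : ℂ) / ((lev L k'' : ℕ) : ℂ)))] : Fin 3 → ((k : ℕ) → Fin d → (idx L (cubic d (evenPeriod t)) k → ℂ))) i) i t) k')ᴴ + Matrix.diagonal ((fun (i : Fin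
                      3) (t : ℕ) => (![(fun (k'' : ℕ) (x' : idx L (cubic d (evenPeriod t)) k'') => -((lev L k'' : ℕ) : ℂ) * ∑ ν, (Complex.I * ((A t) k'' ν x' : ℂ)) * (Complex.exp (Complex.I
                      * ((A₀ t) k'' ν x' : ℂ) / ((lev L k'' : ℕ) : ℂ)) - Complex.exp (-(Complex.I * ((A₀ t) k'' ν x' : ℂ) / ((lev L k'' : ℕ) : ℂ))))), (fun (k'' : ℕ) (x' : idx L (cubic d
                      (evenPeriod t)) k'') => -((lev L k'' : ℕ) : ℂ) * ∑ ν, (Complex.I * ((B t) k'' ν x' : ℂ)) * (Complex.exp (Complex.I * ((A₀ t) k'' ν x' : ℂ) / ((lev L k'' : ℕ) : ℂ)) -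
                      Complex.exp (-(Complex.I * ((A₀ t) k'' ν x' : ℂ) / ((lev L k'' : ℕ) : ℂ))))), (fun (k'' : ℕ) (x' : idx L (cubic d (evenPeriod t)) k'') => -∑ ν, (Complex.I * ((A t) k''
                      ν x' : ℂ)) * (Complex.I * ((B t) k'' ν x' : ℂ)) * (Complex.exp (Complex.I * ((A₀ t) k'' ν x' : ℂ) / ((lev L k'' : ℕ) : ℂ)) + Complex.exp (-(Complex.I * ((A₀ t) k'' ν
                      x' : ℂ) / ((lev L k'' : ℕ) : ℂ)))))] : Fin 3 → ((k : ℕ) → (idx L (cubic d (evenPeriod t)) k → ℂ))) i) i t k')) * N)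
              (calDalev L (cubic d (evenPeriod t)) a ha k' + (1 : ℂ) • (Pmodel L (cubic d (evenPeriod t)) ((fun t => connV L (cubic d (evenPeriod t)) (fun k'' ν' (x' : idx L (cubic d
                    (evenPeriod t)) k'') => Complex.exp (Complex.I * ((A₀ t) k'' ν' x' : ℂ) / ((lev L k'' : ℕ) : ℂ)))) t) k' + (Pmodel L (cubic d (evenPeriod t)) ((fun t => connV L (cubic d
                    (evenPeriod t)) (fun k'' ν' (x' : idx L (cubic d (evenPeriod t)) k'') => Complex.exp (Complex.I * ((A₀ t) k'' ν' x' : ℂ) / ((lev L k'' : ℕ) : ℂ)))) t) k')ᴴ +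
                    Matrix.diagonal ((fun t => zT L (cubic d (evenPeriod t)) (fun k'' ν' (x' : idx L (cubic d (evenPeriod t)) k'') => Complex.exp (Complex.I * ((A₀ t) k'' ν' x' : ℂ) / ((lev
                    L k'' : ℕ) : ℂ)))) t k')))⁻¹ w) k)).prod) t k := by
    intro t
    rw [deriv_deriv_invCov_expChartAt₂_eq_mixedDiagram L (cubic d (evenPeriod t)) a ha (A₀ t) (A t) (B t) k (h0 t) (hc0 t)]
    simp only [Finset.sum_apply, Pi.smul_apply, Pi.list_prod_apply, Fin.sum_univ_five, Matrix.cons_val, List.map_cons, List.map_nil, List.prod_cons, List.prod_nil,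
      Option.elim, List.foldr_cons, List.foldr_nil, one_smul, neg_smul, Matrix.mul_one, Matrix.mul_assoc, sub_eq_add_neg, ← covPert_eq]
  have e : (fun t μ' ν' (z : Site d (evenPeriod t)) =>
          ((deriv (fun r : ℝ => deriv (fun s : ℝ => (avgTow (QBlev L (cubic d (evenPeriod t))) ((L : ℝ) ^ d)
        (fun k' => (calDalev L (cubic d (evenPeriod t)) a ha k' + covPert L (cubic d (evenPeriod t)) (fun k'' ν' (x' : idx L (cubic d (evenPeriod t)) k'') => Complex.exp (Complex.I * ((A₀
              t) k'' ν' x' : ℂ) / ((lev L k'' : ℕ) : ℂ) + (Complex.I * ((A t) k'' ν' x' : ℂ) / ((lev L k'' : ℕ) : ℂ)) * ((s : ℝ) : ℂ) + (Complex.I * ((B t) k'' ν' x' : ℂ) / ((lev L k'' : ℕ)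
              : ℂ)) * ((r : ℝ) : ℂ))) k')⁻¹) k)⁻¹) 0) 0)
            ((unitIdx L (cubic d (evenPeriod t))).symm (z, μ')) ((unitIdx L (cubic d (evenPeriod t))).symm (0, ν'))).re)
      = fun t μ' ν' (z : Site d (evenPeriod t)) =>
          (((∑ j ∈ (Finset.univ : Finset (Fin 5)), (![1, 1, -1, -1, 1] : Fin 5 → ℂ) j • ((((![[none, some [1], none, some [0], none], [none, some [0], none, some [1], none], [none, some [1,
                0], none], [none, some [0, 1], none], [none, some [2], none]] : Fin 5 → List (Option (List (Fin 3))))) j).map fun o => o.elim (fun t k => (avgTow (QBlev L (cubic d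
                (evenPeriod t))) ((L : ℝ) ^ d)
            (fun k' => (calDalev L (cubic d (evenPeriod t)) a ha k' + (1 : ℂ) • (Pmodel L (cubic d (evenPeriod t)) ((fun t => connV L (cubic d (evenPeriod t)) (fun k'' ν' (x' : idx L (cubic
                  d (evenPeriod t)) k'') => Complex.exp (Complex.I * ((A₀ t) k'' ν' x' : ℂ) / ((lev L k'' : ℕ) : ℂ)))) t) k' + (Pmodel L (cubic d (evenPeriod t)) ((fun t => connV L (cubic d
                  (evenPeriod t)) (fun k'' ν' (x' : idx L (cubic d (evenPeriod t)) k'') => Complex.exp (Complex.I * ((A₀ t) k'' ν' x' : ℂ) / ((lev L k'' : ℕ) : ℂ)))) t) k')ᴴ +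
                  Matrix.diagonal ((fun t => zT L (cubic d (evenPeriod t)) (fun k'' ν' (x' : idx L (cubic d (evenPeriod t)) k'') => Complex.exp (Complex.I * ((A₀ t) k'' ν' x' : ℂ) / ((lev L
                  k'' : ℕ) : ℂ)))) t k')))⁻¹) k)⁻¹)
          (fun w t k => avgTow (QBlev L (cubic d (evenPeriod t))) ((L : ℝ) ^ d)
            (fun k' => List.foldr (fun i N =>
                (calDalev L (cubic d (evenPeriod t)) a ha k' + (1 : ℂ) • (Pmodel L (cubic d (evenPeriod t)) ((fun t => connV L (cubic d (evenPeriod t)) (fun k'' ν' (x' : idx L (cubic d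
                      (evenPeriod t)) k'') => Complex.exp (Complex.I * ((A₀ t) k'' ν' x' : ℂ) / ((lev L k'' : ℕ) : ℂ)))) t) k' + (Pmodel L (cubic d (evenPeriod t)) ((fun t => connV L (cubic
                      d (evenPeriod t)) (fun k'' ν' (x' : idx L (cubic d (evenPeriod t)) k'') => Complex.exp (Complex.I * ((A₀ t) k'' ν' x' : ℂ) / ((lev L k'' : ℕ) : ℂ)))) t) k')ᴴ +
                      Matrix.diagonal ((fun t => zT L (cubic d (evenPeriod t)) (fun k'' ν' (x' : idx L (cubic d (evenPeriod t)) k'') => Complex.exp (Complex.I * ((A₀ t) k'' ν' x' : ℂ) /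
                      ((lev L k'' : ℕ) : ℂ)))) t k')))⁻¹
                * (Pmodel L (cubic d (evenPeriod t)) ((fun (i : Fin 3) (t : ℕ) => (![(fun k'' ν' (x' : idx L (cubic d (evenPeriod t)) k'') => -(Complex.I * ((A t) k'' ν' x' : ℂ)) *
                      Complex.exp (Complex.I * ((A₀ t) k'' ν' x' : ℂ) / ((lev L k'' : ℕ) : ℂ))), (fun k'' ν' (x' : idx L (cubic d (evenPeriod t)) k'') => -(Complex.I * ((B t) k'' ν' x' :
                      ℂ)) * Complex.exp (Complex.I * ((A₀ t) k'' ν' x' : ℂ) / ((lev L k'' : ℕ) : ℂ))), (fun k'' ν' (x' : idx L (cubic d (evenPeriod t)) k'') => -(Complex.I * ((A t) k'' ν'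
                      x' : ℂ)) * (Complex.I * ((B t) k'' ν' x' : ℂ) / ((lev L k'' : ℕ) : ℂ)) * Complex.exp (Complex.I * ((A₀ t) k'' ν' x' : ℂ) / ((lev L k'' : ℕ) : ℂ)))] : Fin 3 → ((k : ℕ)
                      → Fin d → (idx L (cubic d (evenPeriod t)) k → ℂ))) i) i t) k' + (Pmodel L (cubic d (evenPeriod t)) ((fun (i : Fin 3) (t : ℕ) => (![(fun k'' ν' (x' : idx L (cubic d
                      (evenPeriod t)) k'') => -(Complex.I * ((A t) k'' ν' x' : ℂ)) * Complex.exp (Complex.I * ((A₀ t) k'' ν' x' : ℂ) / ((lev L k'' : ℕ) : ℂ))), (fun k'' ν' (x' : idx L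
                      (cubic d (evenPeriod t)) k'') => -(Complex.I * ((B t) k'' ν' x' : ℂ)) * Complex.exp (Complex.I * ((A₀ t) k'' ν' x' : ℂ) / ((lev L k'' : ℕ) : ℂ))), (fun k'' ν' (x' :
                      idx L (cubic d (evenPeriod t)) k'') => -(Complex.I * ((A t) k'' ν' x' : ℂ)) * (Complex.I * ((B t) k'' ν' x' : ℂ) / ((lev L k'' : ℕ) : ℂ)) * Complex.exp (Complex.I *
                      ((A₀ t) k'' ν' x' : ℂ) / ((lev L k'' : ℕ) : ℂ)))] : Fin 3 → ((k : ℕ) → Fin d → (idx L (cubic d (evenPeriod t)) k → ℂ))) i) i t) k')ᴴ + Matrix.diagonal ((fun (i : Fin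
                      3) (t : ℕ) => (![(fun (k'' : ℕ) (x' : idx L (cubic d (evenPeriod t)) k'') => -((lev L k'' : ℕ) : ℂ) * ∑ ν, (Complex.I * ((A t) k'' ν x' : ℂ)) * (Complex.exp (Complex.I
                      * ((A₀ t) k'' ν x' : ℂ) / ((lev L k'' : ℕ) : ℂ)) - Complex.exp (-(Complex.I * ((A₀ t) k'' ν x' : ℂ) / ((lev L k'' : ℕ) : ℂ))))), (fun (k'' : ℕ) (x' : idx L (cubic d
                      (evenPeriod t)) k'') => -((lev L k'' : ℕ) : ℂ) * ∑ ν, (Complex.I * ((B t) k'' ν x' : ℂ)) * (Complex.exp (Complex.I * ((A₀ t) k'' ν x' : ℂ) / ((lev L k'' : ℕ) : ℂ)) -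
                      Complex.exp (-(Complex.I * ((A₀ t) k'' ν x' : ℂ) / ((lev L k'' : ℕ) : ℂ))))), (fun (k'' : ℕ) (x' : idx L (cubic d (evenPeriod t)) k'') => -∑ ν, (Complex.I * ((A t) k''
                      ν x' : ℂ)) * (Complex.I * ((B t) k'' ν x' : ℂ)) * (Complex.exp (Complex.I * ((A₀ t) k'' ν x' : ℂ) / ((lev L k'' : ℕ) : ℂ)) + Complex.exp (-(Complex.I * ((A₀ t) k'' ν
                      x' : ℂ) / ((lev L k'' : ℕ) : ℂ)))))] : Fin 3 → ((k : ℕ) → (idx L (cubic d (evenPeriod t)) k → ℂ))) i) i t k')) * N)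
              (calDalev L (cubic d (evenPeriod t)) a ha k' + (1 : ℂ) • (Pmodel L (cubic d (evenPeriod t)) ((fun t => connV L (cubic d (evenPeriod t)) (fun k'' ν' (x' : idx L (cubic d
                    (evenPeriod t)) k'') => Complex.exp (Complex.I * ((A₀ t) k'' ν' x' : ℂ) / ((lev L k'' : ℕ) : ℂ)))) t) k' + (Pmodel L (cubic d (evenPeriod t)) ((fun t => connV L (cubic d
                    (evenPeriod t)) (fun k'' ν' (x' : idx L (cubic d (evenPeriod t)) k'') => Complex.exp (Complex.I * ((A₀ t) k'' ν' x' : ℂ) / ((lev L k'' : ℕ) : ℂ)))) t) k')ᴴ +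
                    Matrix.diagonal ((fun t => zT L (cubic d (evenPeriod t)) (fun k'' ν' (x' : idx L (cubic d (evenPeriod t)) k'') => Complex.exp (Complex.I * ((A₀ t) k'' ν' x' : ℂ) / ((lev
                    L k'' : ℕ) : ℂ)))) t k')))⁻¹ w) k)).prod) t k)
            ((unitIdx L (cubic d (evenPeriod t))).symm (z, μ')) ((unitIdx L (cubic d (evenPeriod t))).symm (0, ν'))).re := by
    funext t μ' ν' z
    rw [key t]
  rw [e]
  exact hIVL k

end End

end Summit.QuantumFields.BalabanUV.Beta.GAN24.ExponentialChartBaseCovariantTaylorEnd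

end
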